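import Summits.SmoothPoincare4.SmoothPoincare4.Theses.InformationMetricHadamard
import Summits.SmoothPoincare4.SmoothPoincare4.Theorems.InformationMetricHadamardC0AhRecognitionStubNearLevelSectionAux2
import Literature.Geometry.Riemannian.NormalExpLevelSets
import Literature.Geometry.Riemannian.CutLocusBishopExp
import Literature.Geometry.Riemannian.HopfRinowCompact

/-!
# Stub `stub_nearLevelSection` of line `core-distance-morse` — auxiliary file 3: the one-sided
# tubular level theorem (crux `InformationMetricHadamard.C0AhRecognition`, stmt-SmoothPoincare4-6015)

Let `(W⁵, G)` be a Riemannian manifold with compact closed distance balls, `ι : N⁴ → W` (`N`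
compact, nonempty) an injective immersion with a smooth `G`-unit normal field `ν`, and `U ⊆ W` an
open set with `∂U = range ι` into which `ν` points (`hside`: curves leaving `ι z` with velocity
`ν z` are in `U` just after and outside `U` just before time `0`). Then for all small `a > 0` the
level `{y | d_G(y, W ∖ U) = a}` is the image of the smooth injective immersion
`z ↦ E(z, a) = exp_{ι z}(a ν z)`. Ingredients: the calibrated tube of `helper_nearLevelSection_2`
(`|Δτ| ≤ L_G` in the tube, closed sub-tubes closed), the two sides of the tube
(`NearLevelSection.tube_sides`), the unit-speed normal geodesics (`d(ι z, E(z,t)) ≤ t`), and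
first-exit arguments along almost-minimising `C¹` paths.

* `NearLevelSection.exists_abs_gt_of_exit` — a path in the tube accumulating at a point outside it
  reaches normal heights `> ε'` for every `ε' < ε`;
* `helper_nearLevelSection_3` — the registered helper (the theorem above).

Everything is proved (kind = proof); no definitions.
-/

noncomputable section

-- the prescribed namespace `Summit.<P>.<Sub>.…` duplicates `SmoothPoincare4` (P = Sub)
set_option linter.dupNamespace false

open scoped Manifold ContDiff Topology ENNReal NNReal
open Set Function Bundle Filter Manifold

namespace Summit.SmoothPoincare4.SmoothPoincare4.Cruxes.C0AhRecognition.CoreDistanceMorse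

open Literature.Geometry.Lorentzian Literature.Geometry.Lorentzian.PseudoRiemannianMetric
  Literature.Geometry.Riemannian

namespace NearLevelSection

/-- **Exit through the top or bottom of the tube.** If `J ⊆ ℝ` is mapped by the continuous `γ`
into the source of a chart `ψ` whose closed sub-tubes `{|τ| ≤ ε'}` (`ε' < ε`) are closed, and
some point `r₀ ∈ cl J` is mapped outside the source, then `|τ(γ r)| > ε'` for some `r ∈ J`.
[folklore] -/
theorem exists_abs_gt_of_exit {N W : Type} [TopologicalSpace N] [TopologicalSpace W]
    (ψ : OpenPartialHomeomorph W (N × ℝ)) {ε ε' : ℝ} (hε' : ε' < ε)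
    (hclos : ∀ ε' : ℝ, ε' < ε → ∀ S : Set W, S ⊆ ψ.source → (∀ x ∈ S, |(ψ x).2| ≤ ε') →
      closure S ⊆ ψ.source)
    {γ : ℝ → W} (hγ : Continuous γ) {J : Set ℝ} (hJ : ∀ r ∈ J, γ r ∈ ψ.source)
    {r₀ : ℝ} (hr₀ : r₀ ∈ closure J) (hout : γ r₀ ∉ ψ.source) :
    ∃ r ∈ J, ε' < |(ψ (γ r)).2| := by
  by_contra h
  push Not at h
  have hS : closure (γ '' J) ⊆ ψ.source :=
    hclos ε' hε' (γ '' J) (by rintro _ ⟨r, hr, rfl⟩; exact hJ r hr)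
      (by rintro _ ⟨r, hr, rfl⟩; exact h r hr)
  exact hout (hS (hγ.continuousWithinAt.mem_closure_image hr₀))

end NearLevelSection

/-- **Helper 3 for stub E2 (`nearLevelSection`): the one-sided tubular level theorem.** See the
module docstring. For `a₀ = ε/4`, `ε` the width of the calibrated tube, and `a ∈ (0, a₀)`:
`j = E(·, a)` is smooth (`contMDiffAt_normalExp_level`), injective (`E` is injective on the tube)
and immersive (`dE` is injective on the tube, `d(E(·,a)) w = dE(w, 0)`); `d(E(z,a), W ∖ U) = a`
(`≤`: the normal geodesic from `ι z ∈ W ∖ U` has length `a`; `≥`: a `C¹` path from `E(z, a)` to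
`W ∖ U` either stays in the tube, where `W ∖ U` has `τ ≤ 0`, or first leaves it through
`|τ| > 3ε/4`; calibration); conversely a point `y` at distance `a` from `W ∖ U` lies in `U`, an
almost-minimising path from `y` first meets `∂U = range ι ⊆ tube` and, read backwards, cannot
leave the tube, so `y = E(z, t)` with `|t| ≤ a`, `t > 0` (sides) and `a ≤ t` (the normal
geodesic). (Lee 2018, Thm. 5.25, Prop. 6.37, Thm. 6.34; Gray, *Tubes*, Lemma 3.2.)
[cite: LeeRiemannianManifolds2018, Thm. 5.25 and Prop. 5.26] -/
theorem helper_nearLevelSection_3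
    (N : Type) [TopologicalSpace N] [CompactSpace N] [Nonempty N]
    [ChartedSpace (EuclideanSpace ℝ (Fin 4)) N] [IsManifold (𝓡 4) ∞ N]
    (W : Type) [TopologicalSpace W] [T2Space W]
    [ChartedSpace (EuclideanSpace ℝ (Fin 5)) W] [IsManifold (𝓡 5) ∞ W]
    (G : PseudoRiemannianMetric (𝓡 5) ∞ (EuclideanSpace ℝ (Fin 5)) (TangentSpace (𝓡 5) : W → Type _))
    (hG : G.IsRiemannian)
    (hcpt : ∀ (x : W) (r : NNReal), IsCompact {y : W | G.edist hG x y ≤ r})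
    (ι : N → W) (hinj : Injective ι) (himm : ∀ z : N, Injective (mfderiv (𝓡 4) (𝓡 5) ι z))
    (ν : Π z : N, TangentSpace (𝓡 5) (ι z))
    (hν : ContMDiff (𝓡 4) (𝓡 5).tangent ∞ (fun z ↦
      (Bundle.TotalSpace.mk' (EuclideanSpace ℝ (Fin 5)) (ι z) (ν z) : TangentBundle (𝓡 5) W)))
    (hunit : ∀ z : N, G.val (ι z) (ν z) (ν z) = 1)
    (hperp : ∀ (z : N) (w : TangentSpace (𝓡 4) z),
      G.val (ι z) (mfderiv (𝓡 4) (𝓡 5) ι z w) (ν z) = 0)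
    (U : Set W) (hUo : IsOpen U) (hfr : frontier U = range ι)
    (hside : ∀ (z : N) (γ : ℝ → W), γ 0 = ι z → MDifferentiableAt 𝓘(ℝ, ℝ) (𝓡 5) γ 0 →
      mfderiv 𝓘(ℝ, ℝ) (𝓡 5) γ 0 1 = ν z →
      (∀ᶠ t in 𝓝[>] (0 : ℝ), γ t ∈ U) ∧ (∀ᶠ t in 𝓝[<] (0 : ℝ), γ t ∉ U)) :
    ∃ a₀ : ℝ, 0 < a₀ ∧ ∀ a ∈ Ioo (0 : ℝ) a₀, ∃ j : N → W,
      ContMDiff (𝓡 4) (𝓡 5) ∞ j ∧ Injective j ∧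
      (∀ x : N, Injective (mfderiv (𝓡 4) (𝓡 5) j x)) ∧
      range j = {y : W | ⨅ k ∈ Uᶜ, G.edist hG y k = ENNReal.ofReal a} := by
  -- the Levi-Civita connection of `G`, its regularity, completeness
  haveI hLC : G.HasLeviCivita := G.hasLeviCivita
  have hk1 : ((1 : ℕ∞) : ℕ∞ω) + 1 ≤ ((⊤ : ℕ∞) : ℕ∞ω) := by
    rw [show ((1 : ℕ∞) : ℕ∞ω) + 1 = 2 by norm_num]
    exact WithTop.coe_le_coe.2 le_top
  haveI : CovariantDerivative.ContMDiffCovariantDerivative G.leviCivita 1 :=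
    ⟨G.isLocallyContMDiff_leviCivita_holds 1 hk1 univ isOpen_univ⟩
  haveI : CovariantDerivative.ContMDiffCovariantDerivative G.leviCivita ((⊤ : ℕ∞) : ℕ∞ω) :=
    ⟨G.isLocallyContMDiff_leviCivita_holds ⊤ (le_of_eq rfl) univ isOpen_univ⟩
  have hc : IsGeodesicallyComplete G.leviCivita := isGeodesicallyComplete_of_isCompact_closedBall hG hcpt
  -- the calibrated tube
  obtain ⟨ε, hε, hdom, hinjOn, hdE, ψ, hsrc, htgt, hsymm, hleft, -, hψsymm, hcal, hclos⟩ :=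
    helper_nearLevelSection_2 N W G hG ι hinj himm ν hν hunit hperp
  set NE : N × ℝ → W := fun q ↦ expMap G.leviCivita (ι q.1) (q.2 • ν q.1) with hNE
  have hNE0 : ∀ z : N, NE (z, 0) = ι z := fun z ↦ normalExp_zero (cov := G.leviCivita) z
  have hNEc : ContinuousOn NE ((univ : Set N) ×ˢ Ioo (-ε) ε) := by
    have h := hψsymm.continuousOn
    rw [htgt] at h
    exact h.congr fun q _ ↦ (hsymm q).symm
  have hmemT : ∀ (z : N) (t : ℝ), t ∈ Ioo (-ε) ε → NE (z, t) ∈ ψ.source := fun z t ht ↦ by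
    rw [hsrc]; exact mem_image_of_mem _ (mk_mem_prod (mem_univ z) ht)
  have hτE : ∀ (z : N) (t : ℝ), t ∈ Ioo (-ε) ε → (ψ (NE (z, t))).2 = t := fun z t ht ↦
    congrArg Prod.snd (hleft (z, t) (mk_mem_prod (mem_univ z) ht))
  have hsrcT : ∀ x ∈ ψ.source, NE (ψ x) = x ∧ (ψ x).2 ∈ Ioo (-ε) ε := fun x hx ↦ by
    refine ⟨?_, ?_⟩
    · have h := ψ.left_inv hx
      rw [hsymm] at h
      exact h
    · have h := ψ.map_source hx
      rw [htgt] at h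
      exact h.2
  -- the hypersurface lies in `W ∖ U`
  have hιK : ∀ z : N, ι z ∉ U := fun z hz ↦ by
    have hfrz : ι z ∈ frontier U := hfr ▸ mem_range_self z
    have h := hUo.inter_frontier_eq
    exact (h.subset ⟨hz, hfrz⟩ : ι z ∈ (∅ : Set W))
  -- the two sides of the tube
  have hS : ∀ z : N, (∀ t ∈ Ioo 0 ε, NE (z, t) ∈ U) ∧ (∀ t ∈ Ioo (-ε) 0, NE (z, t) ∉ closure U) := by
    intro z
    have hgeo := isGeodesicOn_expMap_smul (cov := G.leviCivita) (ι z) (ν z)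
    have hTd : MDifferentiableAt 𝓘(ℝ, ℝ) (𝓡 5) (fun t : ℝ ↦ NE (z, t)) 0 :=
      mdifferentiableAt_of_mdifferentiableAt_lift (hgeo.1 0 (mem_normalExpDomain_zero z))
    have hTv : mfderiv 𝓘(ℝ, ℝ) (𝓡 5) (fun t : ℝ ↦ NE (z, t)) 0 1 = ν z :=
      velocity_expMap_smul_zero (cov := G.leviCivita) (ι z) (ν z)
    obtain ⟨hplus, hminus⟩ := hside z (fun t : ℝ ↦ NE (z, t)) (hNE0 z) hTd hTv
    exact NearLevelSection.tube_sides hNE0 hinjOn hNEc hUo hfr z hplus hminus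
  have hKτ : ∀ x ∈ ψ.source, x ∉ U → (ψ x).2 ≤ 0 := fun x hx hxU ↦ by
    by_contra hpos
    push Not at hpos
    obtain ⟨hxE, hxt⟩ := hsrcT x hx
    have h := (hS (ψ x).1).1 (ψ x).2 ⟨hpos, hxt.2⟩
    rw [hxE] at h
    exact hxU h
  have hUτ : ∀ x ∈ ψ.source, x ∈ U → 0 < (ψ x).2 := fun x hx hxU ↦ by
    obtain ⟨hxE, hxt⟩ := hsrcT x hx
    rcases lt_trichotomy (ψ x).2 0 with hlt | heq | hgt
    · have h := (hS (ψ x).1).2 (ψ x).2 ⟨hxt.1, hlt⟩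
      rw [hxE] at h
      exact absurd (subset_closure hxU) h
    · have h : NE ((ψ x).1, 0) = x := by rw [← heq]; exact hxE
      rw [hNE0] at h
      exact absurd (h ▸ hxU) (hιK _)
    · exact hgt
  -- the normal geodesics have unit speed: `d(E(z,t), ι z) ≤ t`
  have hle : ∀ (z : N) (t : ℝ), 0 ≤ t → G.edist hG (NE (z, t)) (ι z) ≤ ENNReal.ofReal t := by
    intro z t ht
    rw [PseudoRiemannianMetric.edist_comm]
    have h := edist_maximalGeodesic_le hG hc (ι z) (hunit z) ht
    obtain ⟨-, -, h0, -⟩ := maximalGeodesic_spec' (cov := G.leviCivita) (ι z) (ν z)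
    rw [h0, sub_zero, ← expMap_smul hc] at h
    exact h
  -- `d(E(z,t), W ∖ U) ≥ t` for `0 < t ≤ ε/4`
  have hge : ∀ (z : N) (t : ℝ), 0 < t → t ≤ ε / 4 → ∀ k : W, k ∉ U →
      ENNReal.ofReal t ≤ G.edist hG (NE (z, t)) k := by
    intro z t ht0 htε k hkU
    by_contra hlt
    push Not at hlt
    letI := G.riemannianBundle hG
    have hlt' : riemannianEDist (𝓡 5) (NE (z, t)) k < ENNReal.ofReal t := hlt
    obtain ⟨γ, hγ0, hγ1, hγsm, hγlen, -⟩ :=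
      exists_lt_locally_constant_of_riemannianEDist_lt hlt' zero_lt_one
    have htT : t ∈ Ioo (-ε) ε := ⟨by linarith, by linarith⟩
    have hγ0T : γ 0 ∈ ψ.source := hγ0 ▸ hmemT z t htT
    have hτ0 : (ψ (γ 0)).2 = t := by rw [hγ0]; exact hτE z t htT
    have hlen1 : ∀ r ∈ Icc (0 : ℝ) 1, G.length hG γ 0 r < ENNReal.ofReal t := fun r hr ↦
      lt_of_le_of_lt (pathELength_mono le_rfl hr.2) hγlen
    by_cases hall : ∀ r ∈ Icc (0 : ℝ) 1, γ r ∈ ψ.source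
    · -- the path stays in the tube: `|τ(k) - t| ≤ L(γ) < t` with `τ(k) ≤ 0`
      have hcal1 := hcal γ hγsm 0 1 zero_le_one hall
      rw [hγ1, hτ0] at hcal1
      have hk1 : (ψ k).2 ≤ 0 := hKτ k (hγ1 ▸ hall 1 ⟨zero_le_one, le_rfl⟩) hkU
      have habs : t ≤ |(ψ k).2 - t| := by
        rw [abs_sub_comm]
        exact le_trans (by linarith) (le_abs_self _)
      exact absurd ((ENNReal.ofReal_le_ofReal habs).trans hcal1) (not_le.2 (hlen1 1 ⟨zero_le_one, le_rfl⟩))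
    · -- the path leaves the tube: first exit time `c₀`, before which `|τ| > 3ε/4` somewhere
      push Not at hall
      obtain ⟨r₁, hr₁, hr₁T⟩ := hall
      set Sx : Set ℝ := Icc (0 : ℝ) 1 ∩ γ ⁻¹' (ψ.source)ᶜ with hSx
      have hSxc : IsClosed Sx := isClosed_Icc.inter (ψ.open_source.isClosed_compl.preimage hγsm.continuous)
      have hSbdd : BddBelow Sx := ⟨0, fun r hr ↦ hr.1.1⟩
      set c₀ : ℝ := sInf Sx with hc₀
      have hc₀S : c₀ ∈ Sx := hSxc.csInf_mem ⟨r₁, hr₁, hr₁T⟩ hSbdd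
      have hc₀0 : 0 < c₀ := hc₀S.1.1.lt_of_ne (by rintro h; rw [← h] at hc₀S; exact hc₀S.2 hγ0T)
      have hin : ∀ r ∈ Ico (0 : ℝ) c₀, γ r ∈ ψ.source := fun r hr ↦ by
        by_contra hrT
        exact absurd hr.2 (not_lt.2 (csInf_le hSbdd ⟨⟨hr.1, hr.2.le.trans hc₀S.1.2⟩, hrT⟩))
      obtain ⟨r, hr, hrτ⟩ := NearLevelSection.exists_abs_gt_of_exit ψ (ε' := 3 * ε / 4) (by linarith)
        hclos hγsm.continuous hin (by rw [closure_Ico hc₀0.ne]; exact right_mem_Icc.2 hc₀0.le) hc₀S.2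
      have hcal2 := hcal γ hγsm 0 r hr.1 fun r' hr' ↦ hin r' ⟨hr'.1, hr'.2.trans_lt hr.2⟩
      rw [hτ0] at hcal2
      have habs : t ≤ |(ψ (γ r)).2 - t| := by
        have h1 : |(ψ (γ r)).2| - |t| ≤ |(ψ (γ r)).2 - t| := abs_sub_abs_le_abs_sub _ _
        rw [abs_of_pos ht0] at h1
        linarith
      exact absurd ((ENNReal.ofReal_le_ofReal habs).trans hcal2)
        (not_le.2 (hlen1 r ⟨hr.1, hr.2.le.trans hc₀S.1.2⟩))
  -- a point at distance `a ≤ ε/4` from `W ∖ U` is `E(z, a)`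
  have hlevel : ∀ (a : ℝ), 0 < a → a ≤ ε / 4 → ∀ y : W,
      (⨅ k ∈ Uᶜ, G.edist hG y k) = ENNReal.ofReal a → ∃ z : N, NE (z, a) = y := by
    intro a ha0 haε y hy
    have hyU : y ∈ U := by
      by_contra hyK
      have h0 : (⨅ k ∈ Uᶜ, G.edist hG y k) ≤ 0 :=
        (iInf₂_le y hyK).trans (by rw [PseudoRiemannianMetric.edist_self])
      rw [hy] at h0
      exact absurd (ENNReal.ofReal_pos.2 ha0) (not_lt.2 h0)
    -- almost-minimising paths read in the tube
    have key : ∀ η : ℝ, 0 < η → η ≤ ε / 4 → y ∈ ψ.source ∧ |(ψ y).2| < a + η := by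
      intro η hη0 hηε
      have hlt : (⨅ k ∈ Uᶜ, G.edist hG y k) < ENNReal.ofReal (a + η) := by
        rw [hy]
        exact (ENNReal.ofReal_lt_ofReal_iff (by linarith)).2 (by linarith)
      obtain ⟨k, hkK, hk⟩ : ∃ k ∈ Uᶜ, G.edist hG y k < ENNReal.ofReal (a + η) := by
        simpa only [iInf_lt_iff, exists_prop] using hlt
      letI := G.riemannianBundle hG
      have hk' : riemannianEDist (𝓡 5) y k < ENNReal.ofReal (a + η) := hk
      obtain ⟨γ, hγ0, hγ1, hγsm, hγlen, -⟩ :=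
        exists_lt_locally_constant_of_riemannianEDist_lt hk' zero_lt_one
      have hlen1 : ∀ r r' : ℝ, 0 ≤ r → r' ≤ 1 → G.length hG γ r r' < ENNReal.ofReal (a + η) :=
        fun r r' hr hr' ↦ lt_of_le_of_lt (pathELength_mono hr hr') hγlen
      -- the first exit time `b₀` from `U`; `γ b₀ = ι z'` lies on the hypersurface
      set Bs : Set ℝ := Icc (0 : ℝ) 1 ∩ γ ⁻¹' Uᶜ with hBs
      have hBsc : IsClosed Bs := isClosed_Icc.inter (hUo.isClosed_compl.preimage hγsm.continuous)
      have hBbdd : BddBelow Bs := ⟨0, fun r hr ↦ hr.1.1⟩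
      set b₀ : ℝ := sInf Bs with hb₀
      have hb₀B : b₀ ∈ Bs := hBsc.csInf_mem ⟨1, ⟨zero_le_one, le_rfl⟩, by
        rw [mem_preimage, hγ1]; exact hkK⟩ hBbdd
      have hb₀0 : 0 < b₀ := hb₀B.1.1.lt_of_ne (by
        rintro h; rw [← h] at hb₀B; exact hb₀B.2 (hγ0 ▸ hyU))
      have hinU : ∀ r ∈ Ico (0 : ℝ) b₀, γ r ∈ U := fun r hr ↦ by
        by_contra hrU
        exact absurd hr.2 (not_lt.2 (csInf_le hBbdd ⟨⟨hr.1, hr.2.le.trans hb₀B.1.2⟩, hrU⟩))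
      have hfrb₀ : γ b₀ ∈ frontier U := by
        refine ⟨?_, by rw [hUo.interior_eq]; exact hb₀B.2⟩
        have hmem : γ b₀ ∈ closure (γ '' Ico (0 : ℝ) b₀) :=
          hγsm.continuous.continuousWithinAt.mem_closure_image
            (by rw [closure_Ico hb₀0.ne]; exact right_mem_Icc.2 hb₀0.le)
        exact closure_mono (by rintro _ ⟨r, hr, rfl⟩; exact hinU r hr) hmem
      rw [hfr] at hfrb₀
      obtain ⟨z', hz'⟩ := hfrb₀
      have h0T : (0 : ℝ) ∈ Ioo (-ε) ε := ⟨neg_lt_zero.2 hε, hε⟩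
      have hb₀T : γ b₀ ∈ ψ.source := by rw [← hz', ← hNE0]; exact hmemT z' 0 h0T
      have hτb₀ : (ψ (γ b₀)).2 = 0 := by rw [← hz', ← hNE0 z']; exact hτE z' 0 h0T
      -- read backwards from `b₀`, the path cannot leave the tube
      have hallT : ∀ r ∈ Icc 0 b₀, γ r ∈ ψ.source := by
        by_contra hnot
        push Not at hnot
        obtain ⟨r₁, hr₁, hr₁T⟩ := hnot
        set Cs : Set ℝ := Icc 0 b₀ ∩ γ ⁻¹' (ψ.source)ᶜ with hCs
        have hCsc : IsClosed Cs :=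
          isClosed_Icc.inter (ψ.open_source.isClosed_compl.preimage hγsm.continuous)
        have hCbdd : BddAbove Cs := ⟨b₀, fun r hr ↦ hr.1.2⟩
        set c₁ : ℝ := sSup Cs with hc₁
        have hc₁C : c₁ ∈ Cs := hCsc.csSup_mem ⟨r₁, hr₁, hr₁T⟩ hCbdd
        have hc₁b : c₁ < b₀ := hc₁C.1.2.lt_of_ne (by
          rintro h; rw [h] at hc₁C; exact hc₁C.2 hb₀T)
        have hin : ∀ r ∈ Ioc c₁ b₀, γ r ∈ ψ.source := fun r hr ↦ by
          by_contra hrT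
          exact absurd hr.1 (not_lt.2 (le_csSup hCbdd ⟨⟨hc₁C.1.1.trans hr.1.le, hr.2⟩, hrT⟩))
        obtain ⟨r, hr, hrτ⟩ := NearLevelSection.exists_abs_gt_of_exit ψ (ε' := 3 * ε / 4)
          (by linarith) hclos hγsm.continuous hin
          (by rw [closure_Ioc hc₁b.ne]; exact left_mem_Icc.2 hc₁b.le) hc₁C.2
        have hcal2 := hcal γ hγsm r b₀ hr.2 fun r' hr' ↦ hin r' ⟨hr.1.trans_le hr'.1, hr'.2⟩
        rw [hτb₀, zero_sub, abs_neg] at hcal2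
        have h1 := (hcal2.trans_lt (hlen1 r b₀ (hc₁C.1.1.trans hr.1.le) hb₀B.1.2))
        rw [ENNReal.ofReal_lt_ofReal_iff (by linarith)] at h1
        linarith
      refine ⟨hγ0 ▸ hallT 0 ⟨le_rfl, hb₀0.le⟩, ?_⟩
      have hcal3 := hcal γ hγsm 0 b₀ hb₀0.le hallT
      rw [hτb₀, hγ0, zero_sub, abs_neg] at hcal3
      exact (ENNReal.ofReal_lt_ofReal_iff (by linarith)).1
        (hcal3.trans_lt (hlen1 0 b₀ le_rfl hb₀B.1.2))
    obtain ⟨hyT, -⟩ := key (ε / 4) (by positivity) le_rfl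
    have hτy : |(ψ y).2| ≤ a := by
      refine le_of_forall_pos_lt_add fun η hη ↦ ?_
      rcases le_or_gt η (ε / 4) with h | h
      · exact (key η hη h).2
      · have h2 := (key (ε / 4) (by positivity) le_rfl).2
        linarith
    have hτpos : 0 < (ψ y).2 := hUτ y hyT hyU
    obtain ⟨hyE, -⟩ := hsrcT y hyT
    -- `a ≤ τ(y)`: the normal geodesic from `ι (ψ y).1 ∈ W ∖ U` to `y` has length `τ(y)`
    have h1 : ENNReal.ofReal a ≤ ENNReal.ofReal (ψ y).2 := by
      rw [← hy]
      refine (iInf₂_le (ι (ψ y).1) (hιK _)).trans ?_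
      have h := hle (ψ y).1 (ψ y).2 hτpos.le
      rwa [hyE] at h
    have hat : a ≤ (ψ y).2 := (ENNReal.ofReal_le_ofReal_iff hτpos.le).1 h1
    have hta : (ψ y).2 ≤ a := (abs_of_pos hτpos) ▸ hτy
    have heq : (ψ y).2 = a := le_antisymm hta hat
    refine ⟨(ψ y).1, ?_⟩
    rw [← heq]
    exact hyE
  -- assembly
  refine ⟨ε / 4, by positivity, fun a ha ↦ ?_⟩
  have haT : a ∈ Ioo (-ε) ε := ⟨by linarith [ha.1], by linarith [ha.2]⟩
  refine ⟨fun z ↦ expMap G.leviCivita (ι z) (a • ν z), ?_, ?_, ?_, ?_⟩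
  · exact fun z ↦ contMDiffAt_normalExp_level G hν (hdom z a haT)
  · intro z z' h
    exact congrArg Prod.fst (hinjOn (mk_mem_prod (mem_univ z) haT)
      (mk_mem_prod (mem_univ z') haT) h)
  · intro z w w' h
    rw [mfderiv_normalExp_level_apply G hν (hdom z a haT),
      mfderiv_normalExp_level_apply G hν (hdom z a haT)] at h
    have h2 := hdE (z, a) (mk_mem_prod (mem_univ z) haT) h
    exact congrArg Prod.fst h2
  · ext y
    constructor
    · rintro ⟨z, rfl⟩
      change (⨅ k ∈ Uᶜ, G.edist hG (NE (z, a)) k) = ENNReal.ofReal a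
      apply le_antisymm
      · exact (iInf₂_le (ι z) (hιK z)).trans (hle z a ha.1.le)
      · exact le_iInf₂ fun k hk ↦ hge z a ha.1 ha.2.le k hk
    · intro hy
      obtain ⟨z, hz⟩ := hlevel a ha.1 ha.2.le y hy
      exact ⟨z, hz⟩

end Summit.SmoothPoincare4.SmoothPoincare4.Cruxes.C0AhRecognition.CoreDistanceMorse

end
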